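import Mathlib
import Literature.MathematicalPhysics.QuantumFieldTheory.OSLorentzInvariance
import Literature.MathematicalPhysics.QuantumFieldTheory.OSEuclideanRotationGenerator
import Summits.QuantumFields.YangMills.Theorems.NPointIsotropy.Negative.HyperoctahedralPlane
import HarnessLib

/-!
# Degree-one doubled orbit kernel, I: toolbox

Line `complex-rotation-bandlimit` of crux `PencilRigidity.NPointIsotropy` (stmt-QuantumFields-11686), registered
stub `doubledOrbitKernel_degOne_of_universal` (the degree-1 case of the shared analytic input
`stub_doubledOrbitKernel`): first of four support files.  Generic lemmas, no quantum-field vocabulary beyond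
time-ordering of one-point test functions:

* `differentiableOn_integral_mul` — joint holomorphy of `(z, w) ↦ ∫ A(z,x) B(w,x) dμ(x)` from holomorphy of the
  factors and an integrable domination of `|A||B|, |A'||B|, |A||B'|` (differentiation under the integral sign with
  parameter in `ℂ × ℂ`, `hasFDerivAt_integral_of_dominated_of_fderiv_le`);
* weights: `(1+x)^N ≤ 2^N(1+x^N)`, `(1+2p₀)^N e^{-2sp₀} ≤ (1+N/s)^N`, `1+‖p‖ ≤ (1+2p₀)(1+|p₂|)(1+|p₃|)` on the cone
  `|p₁| ≤ p₀`, and the resulting product bound `mul_le_weight`;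
* `e^{-|χ|} = cosh χ − |sinh χ|` and the boosted-energy inequality `e^{-|χ|}p₀ ≤ cosh χ p₀ − sinh χ p₁` on the cone;
* the margin lemma `exists_margin` (a compactly supported time-ordered one-point test function keeps rotated time
  `≥ δ > 0` under all `(x₀,x₁)`-rotations of angle `< ε₀`) and its consequences for `linActMulti (planeRot 0 η)`;
* supports of (iterated) directional derivatives of Schwartz functions, pointwise polarisation in `ℂ`.
-/

noncomputable section

namespace Summit.QuantumFields.YangMills.Theorems.NPointIsotropy.ComplexRotationBandlimit

open MeasureTheory Complex Set Filter Topology Metric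
open scoped ComplexConjugate SchwartzMap LineDeriv InnerProductSpace
open Literature.MathematicalPhysics.QuantumLattice Literature.MathematicalPhysics.QuantumFieldTheory
open Summit.QuantumFields.YangMills.Theorems.NPointIsotropy.Negative (E4)

/-! ## Joint holomorphy of product parameter integrals -/

/-- **Joint holomorphy of a product parameter integral** `(z, w) ↦ ∫ A(z,x) B(w,x) dμ(x)`:
holomorphic factors with dominated values and derivatives give a jointly holomorphic integral
(differentiation under the integral sign with parameter in `ℂ × ℂ`). [folklore] -/
theorem differentiableOn_integral_mul : ∀ {X : Type*} [MeasurableSpace X] (μ : MeasureTheory.Measure X) {U V : Set ℂ}, IsOpen U → IsOpen V → ∀ (A A' B B' : ℂ → X → ℂ) (bound : X → ℝ), MeasureTheory.Integrable bound μ → (∀ z ∈ U, ∀ x, HasDerivAt (fun z => A z x) (A' z x) z) → (∀ w ∈ V, ∀ x, HasDerivAt (fun w => B w x) (B' w x) w) → (∀ z, MeasureTheory.AEStronglyMeasurable (A z) μ) → (∀ z, MeasureTheory.AEStronglyMeasurable (A' z) μ) → (∀ w, MeasureTheory.AEStronglyMeasurable (B w) μ) → (∀ w, MeasureTheory.AEStronglyMeasurable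 (B' w) μ) → (∀ᵐ x ∂μ, ∀ z ∈ U, ∀ w ∈ V, ‖A z x‖ * ‖B w x‖ ≤ bound x) → (∀ᵐ x ∂μ, ∀ z ∈ U, ∀ w ∈ V, ‖A' z x‖ * ‖B w x‖ ≤ bound x) → (∀ᵐ x ∂μ, ∀ z ∈ U, ∀ w ∈ V, ‖A z x‖ * ‖B' w x‖ ≤ bound x) → DifferentiableOn ℂ (fun zw : ℂ × ℂ => ∫ x, A zw.1 x * B zw.2 x ∂μ) (U ×ˢ V) := by
  intro X _ μ U V hU hV A A' B B' bound hint hA hB hAm hA'm hBm hB'm h1 h2 h3 zw₀ hzw₀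
  obtain ⟨hz₀, hw₀⟩ := mem_prod.1 hzw₀
  have hs : U ×ˢ V ∈ 𝓝 zw₀ := (hU.prod hV).mem_nhds hzw₀
  set L1 : ℂ × ℂ →L[ℂ] ℂ := ContinuousLinearMap.fst ℂ ℂ ℂ with hL1
  set L2 : ℂ × ℂ →L[ℂ] ℂ := ContinuousLinearMap.snd ℂ ℂ ℂ with hL2
  have hnL1 : ‖L1‖ ≤ 1 := ContinuousLinearMap.norm_fst_le ℂ ℂ ℂ
  have hnL2 : ‖L2‖ ≤ 1 := ContinuousLinearMap.norm_snd_le ℂ ℂ ℂ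
  have hint0 : Integrable (fun x => A zw₀.1 x * B zw₀.2 x) μ := by
    refine Integrable.mono' hint ((hAm zw₀.1).mul (hBm zw₀.2)) (h1.mono fun x hx => ?_)
    rw [norm_mul]
    exact hx _ hz₀ _ hw₀
  have hbd : ∀ᵐ x ∂μ, ∀ zw ∈ U ×ˢ V,
      ‖(A zw.1 x * B' zw.2 x) • L2 + (A' zw.1 x * B zw.2 x) • L1‖ ≤ 2 * bound x := by
    filter_upwards [h2, h3] with x hx2 hx3 zw hzw
    obtain ⟨hz, hw⟩ := mem_prod.1 hzw
    have e1 : ‖(A zw.1 x * B' zw.2 x) • L2‖ ≤ ‖A zw.1 x‖ * ‖B' zw.2 x‖ := by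
      rw [norm_smul, norm_mul]
      exact mul_le_of_le_one_right (by positivity) hnL2
    have e2 : ‖(A' zw.1 x * B zw.2 x) • L1‖ ≤ ‖A' zw.1 x‖ * ‖B zw.2 x‖ := by
      rw [norm_smul, norm_mul]
      exact mul_le_of_le_one_right (by positivity) hnL1
    calc ‖(A zw.1 x * B' zw.2 x) • L2 + (A' zw.1 x * B zw.2 x) • L1‖
        ≤ ‖(A zw.1 x * B' zw.2 x) • L2‖ + ‖(A' zw.1 x * B zw.2 x) • L1‖ := norm_add_le _ _
      _ ≤ 2 * bound x := by linarith [hx3 _ hz _ hw, hx2 _ hz _ hw]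
  have hdiff : ∀ᵐ x ∂μ, ∀ zw ∈ U ×ˢ V, HasFDerivAt (fun zw : ℂ × ℂ => A zw.1 x * B zw.2 x)
      ((A zw.1 x * B' zw.2 x) • L2 + (A' zw.1 x * B zw.2 x) • L1) zw := by
    refine ae_of_all _ fun x zw hzw => ?_
    obtain ⟨hz, hw⟩ := mem_prod.1 hzw
    have ha : HasFDerivAt (fun zw : ℂ × ℂ => A zw.1 x)
        ((ContinuousLinearMap.smulRight (1 : ℂ →L[ℂ] ℂ) (A' zw.1 x)).comp L1) zw :=
      (hA zw.1 hz x).hasFDerivAt.comp zw hasFDerivAt_fst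
    have hb : HasFDerivAt (fun zw : ℂ × ℂ => B zw.2 x)
        ((ContinuousLinearMap.smulRight (1 : ℂ →L[ℂ] ℂ) (B' zw.2 x)).comp L2) zw :=
      (hB zw.2 hw x).hasFDerivAt.comp zw hasFDerivAt_snd
    refine (ha.mul hb).congr_fderiv (ContinuousLinearMap.ext fun q => ?_)
    obtain ⟨u, v⟩ := q
    simp [hL1, hL2]
    ring
  have key := hasFDerivAt_integral_of_dominated_of_fderiv_le (μ := μ) (x₀ := zw₀) (s := U ×ˢ V)
    (F := fun zw x => A zw.1 x * B zw.2 x)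
    (F' := fun zw x => (A zw.1 x * B' zw.2 x) • L2 + (A' zw.1 x * B zw.2 x) • L1)
    (bound := fun x => 2 * bound x) hs
    (Eventually.of_forall fun zw => (hAm zw.1).mul (hBm zw.2)) hint0
    ((((hAm zw₀.1).mul (hB'm zw₀.2)).smul_const L2).add
      (((hA'm zw₀.1).mul (hBm zw₀.2)).smul_const L1))
    hbd (hint.const_mul 2) hdiff
  exact key.differentiableAt.differentiableWithinAt

namespace DegOne

/-! ## Weights -/

/-- `(1 + x)^N ≤ 2^N (1 + x^N)` for `x ≥ 0`. [folklore] -/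
theorem one_add_pow_le_two_pow (N : ℕ) {x : ℝ} (hx : 0 ≤ x) : (1 + x) ^ N ≤ 2 ^ N * (1 + x ^ N) := by
  rcases le_or_gt x 1 with h | h
  · calc (1 + x) ^ N ≤ 2 ^ N := pow_le_pow_left₀ (by positivity) (by linarith) N
      _ ≤ 2 ^ N * (1 + x ^ N) := le_mul_of_one_le_right (by positivity) (by
          have : 0 ≤ x ^ N := by positivity
          linarith)
  · calc (1 + x) ^ N ≤ (2 * x) ^ N := pow_le_pow_left₀ (by positivity) (by linarith) N
      _ = 2 ^ N * x ^ N := mul_pow 2 x N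
      _ ≤ 2 ^ N * (1 + x ^ N) := mul_le_mul_of_nonneg_left (by linarith) (by positivity)

/-- **Polynomial decay against the boosted Laplace factor**: `(1 + 2p₀)^N e^{-2 s p₀} ≤ (1 + N/s)^N`
for `p₀ ≥ 0`, `s > 0`. [folklore] -/
theorem one_add_pow_mul_exp_le (N : ℕ) {s p0 : ℝ} (hs : 0 < s) (hp0 : 0 ≤ p0) :
    (1 + 2 * p0) ^ N * Real.exp (-(s * p0)) * Real.exp (-(s * p0)) ≤ (1 + N / s) ^ N := by
  rcases Nat.eq_zero_or_pos N with rfl | hN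
  · have : Real.exp (-(s * p0)) ≤ 1 := Real.exp_le_one_iff.2 (by nlinarith)
    have h0 : 0 ≤ Real.exp (-(s * p0)) := (Real.exp_pos _).le
    simpa using mul_le_one₀ this h0 this
  · have hNr : (0 : ℝ) < N := Nat.cast_pos.2 hN
    -- `1 + 2 p₀ ≤ (1 + N/s) e^{2 s p₀ / N}`
    have h1 : 1 + 2 * p0 ≤ (1 + N / s) * Real.exp (2 * s * p0 / N) := by
      have h2 : 1 + 2 * s * p0 / N ≤ Real.exp (2 * s * p0 / N) := by
        have := Real.add_one_le_exp (2 * s * p0 / N); linarith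
      have h3 : 1 + 2 * p0 ≤ (1 + N / s) * (1 + 2 * s * p0 / N) := by
        have h4 : (1 + N / s) * (1 + 2 * s * p0 / N) = 1 + 2 * p0 + (N / s + 2 * s * p0 / N) := by
          field_simp
          ring
        rw [h4]
        have : 0 ≤ N / s + 2 * s * p0 / N := by positivity
        linarith
      exact h3.trans (mul_le_mul_of_nonneg_left h2 (by positivity))
    have h5 : (1 + 2 * p0) ^ N ≤ (1 + N / s) ^ N * Real.exp (2 * (s * p0)) := by
      calc (1 + 2 * p0) ^ N ≤ ((1 + N / s) * Real.exp (2 * s * p0 / N)) ^ N :=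
            pow_le_pow_left₀ (by positivity) h1 N
        _ = (1 + N / s) ^ N * Real.exp (2 * (s * p0)) := by
            rw [mul_pow, ← Real.exp_nat_mul]
            congr 2
            field_simp
    have h6 : Real.exp (-(s * p0)) * Real.exp (-(s * p0)) * Real.exp (2 * (s * p0)) = 1 := by
      rw [← Real.exp_add, ← Real.exp_add, ← Real.exp_zero]
      congr 1; ring
    have h7 : 0 ≤ Real.exp (-(s * p0)) * Real.exp (-(s * p0)) := by positivity
    calc (1 + 2 * p0) ^ N * Real.exp (-(s * p0)) * Real.exp (-(s * p0))
        = (1 + 2 * p0) ^ N * (Real.exp (-(s * p0)) * Real.exp (-(s * p0))) := by ring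
      _ ≤ (1 + N / s) ^ N * Real.exp (2 * (s * p0)) * (Real.exp (-(s * p0)) * Real.exp (-(s * p0))) :=
          mul_le_mul_of_nonneg_right h5 h7
      _ = (1 + N / s) ^ N := by
          rw [mul_assoc, mul_comm (Real.exp (2 * (s * p0))), h6, mul_one]

/-- **The cone controls the norm by energy and transverse momenta**:
`1 + ‖p‖ ≤ (1 + 2p₀)(1 + |p₂|)(1 + |p₃|)` for `|p₁| ≤ p₀`. [folklore] -/
theorem one_add_norm_le_of_cone {p : E4} (hp : |p 1| ≤ p 0) :
    1 + ‖p‖ ≤ (1 + 2 * p 0) * (1 + |p 2|) * (1 + |p 3|) := by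
  have hp0 : 0 ≤ p 0 := (abs_nonneg _).trans hp
  have hn : ‖p‖ ≤ |p 0| + |p 1| + |p 2| + |p 3| := by
    rw [EuclideanSpace.norm_eq, Real.sqrt_le_left (by positivity), Fin.sum_univ_four]
    simp only [Real.norm_eq_abs, sq_abs]
    nlinarith [abs_nonneg (p 0), abs_nonneg (p 1), abs_nonneg (p 2), abs_nonneg (p 3),
      sq_abs (p 0), sq_abs (p 1), sq_abs (p 2), sq_abs (p 3)]
  rw [abs_of_nonneg hp0] at hn
  have h2 : 0 ≤ |p 2| := abs_nonneg _
  have h3 : 0 ≤ |p 3| := abs_nonneg _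
  nlinarith [mul_nonneg hp0 h2, mul_nonneg hp0 h3, mul_nonneg h2 h3, mul_nonneg (mul_nonneg hp0 h2) h3]

/-- **The weighted product bound**: two nonnegative quantities `X, Y` with Laplace decay
`e^{-s p₀}` and transverse decay of order `N` in `p₂` resp. `p₃` have product
`≤ 4^N (A₀ + A₂)(B₀ + B₃)(1 + N/s)^N (1 + ‖p‖)^{-N}` on the cone. [folklore] -/
theorem mul_le_weight {N : ℕ} {s : ℝ} (hs : 0 < s) {p : E4} (hp : |p 1| ≤ p 0)
    {X Y A0 A2 B0 B3 : ℝ} (hX : 0 ≤ X) (hY : 0 ≤ Y)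
    (h0 : X ≤ A0 * Real.exp (-(s * p 0))) (h2 : |p 2| ^ N * X ≤ A2 * Real.exp (-(s * p 0)))
    (h0' : Y ≤ B0 * Real.exp (-(s * p 0))) (h3 : |p 3| ^ N * Y ≤ B3 * Real.exp (-(s * p 0))) :
    X * Y ≤ 4 ^ N * (A0 + A2) * (B0 + B3) * (1 + N / s) ^ N * (1 + ‖p‖) ^ (-(N : ℝ)) := by
  have hp0 : 0 ≤ p 0 := (abs_nonneg _).trans hp
  set E := Real.exp (-(s * p 0)) with hE
  have hEpos : 0 < E := Real.exp_pos _
  -- transverse weights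
  have hx2 : (1 + |p 2|) ^ N * X ≤ 2 ^ N * (A0 + A2) * E := by
    calc (1 + |p 2|) ^ N * X ≤ 2 ^ N * (1 + |p 2| ^ N) * X :=
          mul_le_mul_of_nonneg_right (one_add_pow_le_two_pow N (abs_nonneg _)) hX
      _ = 2 ^ N * (X + |p 2| ^ N * X) := by ring
      _ ≤ 2 ^ N * (A0 * E + A2 * E) := mul_le_mul_of_nonneg_left (add_le_add h0 h2) (by positivity)
      _ = 2 ^ N * (A0 + A2) * E := by ring
  have hx3 : (1 + |p 3|) ^ N * Y ≤ 2 ^ N * (B0 + B3) * E := by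
    calc (1 + |p 3|) ^ N * Y ≤ 2 ^ N * (1 + |p 3| ^ N) * Y :=
          mul_le_mul_of_nonneg_right (one_add_pow_le_two_pow N (abs_nonneg _)) hY
      _ = 2 ^ N * (Y + |p 3| ^ N * Y) := by ring
      _ ≤ 2 ^ N * (B0 * E + B3 * E) := mul_le_mul_of_nonneg_left (add_le_add h0' h3) (by positivity)
      _ = 2 ^ N * (B0 + B3) * E := by ring
  have hA : 0 ≤ A0 + A2 := by
    have : 0 ≤ 2 ^ N * (A0 + A2) * E := le_trans (by positivity) hx2
    have h' : 0 < (2 : ℝ) ^ N * E := by positivity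
    nlinarith
  have hB : 0 ≤ B0 + B3 := by
    have : 0 ≤ 2 ^ N * (B0 + B3) * E := le_trans (by positivity) hx3
    have h' : 0 < (2 : ℝ) ^ N * E := by positivity
    nlinarith
  -- the full weight
  set W := (1 + 2 * p 0) ^ N * (1 + |p 2|) ^ N * (1 + |p 3|) ^ N with hW
  have hWX : W * (X * Y) ≤ 4 ^ N * (A0 + A2) * (B0 + B3) * (1 + N / s) ^ N := by
    have h4 : (4 : ℝ) ^ N = 2 ^ N * 2 ^ N := by rw [← mul_pow]; norm_num
    calc W * (X * Y) = (1 + 2 * p 0) ^ N * (((1 + |p 2|) ^ N * X) * ((1 + |p 3|) ^ N * Y)) := by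
          rw [hW]; ring
      _ ≤ (1 + 2 * p 0) ^ N * ((2 ^ N * (A0 + A2) * E) * (2 ^ N * (B0 + B3) * E)) :=
          mul_le_mul_of_nonneg_left (mul_le_mul hx2 hx3 (by positivity) (by positivity))
            (by positivity)
      _ = 2 ^ N * 2 ^ N * (A0 + A2) * (B0 + B3) * ((1 + 2 * p 0) ^ N * E * E) := by ring
      _ ≤ 2 ^ N * 2 ^ N * (A0 + A2) * (B0 + B3) * (1 + N / s) ^ N :=
          mul_le_mul_of_nonneg_left (one_add_pow_mul_exp_le N hs hp0) (by positivity)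
      _ = 4 ^ N * (A0 + A2) * (B0 + B3) * (1 + N / s) ^ N := by rw [h4]
  -- compare the weight with `(1 + ‖p‖)^N`
  have hnorm : (1 + ‖p‖) ^ N ≤ W := by
    rw [hW, ← mul_pow, ← mul_pow]
    exact pow_le_pow_left₀ (by positivity) (one_add_norm_le_of_cone hp) N
  have hpos : 0 < (1 + ‖p‖) ^ N := by positivity
  have hC : 0 ≤ 4 ^ N * (A0 + A2) * (B0 + B3) * (1 + N / s) ^ N := by positivity
  rw [Real.rpow_neg (by positivity), Real.rpow_natCast, ← div_eq_mul_inv, le_div_iff₀ hpos]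
  calc X * Y * (1 + ‖p‖) ^ N ≤ X * Y * W := mul_le_mul_of_nonneg_left hnorm (mul_nonneg hX hY)
    _ = W * (X * Y) := by ring
    _ ≤ _ := hWX


/-! ## Hyperbolic inequalities for the boosted energy -/

/-- `e^{-|χ|} = cosh χ − |sinh χ|`. [folklore] -/
theorem exp_neg_abs_eq (χ : ℝ) : Real.exp (-|χ|) = Real.cosh χ - |Real.sinh χ| := by
  rcases le_or_gt 0 χ with h | h
  · rw [abs_of_nonneg h, abs_of_nonneg (Real.sinh_nonneg_iff.2 h), Real.cosh_sub_sinh]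
  · rw [abs_of_neg h, abs_of_neg (Real.sinh_neg_iff.2 h), neg_neg, sub_neg_eq_add, Real.cosh_add_sinh]

/-- **The boosted energy dominates `e^{-|χ|} p₀` on the cone** `|p₁| ≤ p₀`. [folklore] -/
theorem exp_neg_abs_mul_le {χ p0 p1 : ℝ} (hp : |p1| ≤ p0) :
    Real.exp (-|χ|) * p0 ≤ Real.cosh χ * p0 - Real.sinh χ * p1 := by
  rw [exp_neg_abs_eq, sub_mul]
  have h1 : Real.sinh χ * p1 ≤ |Real.sinh χ| * |p1| := by
    rw [← abs_mul]; exact le_abs_self _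
  have h2 : |Real.sinh χ| * |p1| ≤ |Real.sinh χ| * p0 := mul_le_mul_of_nonneg_left hp (abs_nonneg _)
  linarith

/-- Real and imaginary parts move by at most the radius on a circle. [folklore] -/
theorem abs_re_im_le_of_mem_sphere {θ ζ : ℂ} {r : ℝ} (hζ : ζ ∈ sphere θ r) :
    |ζ.re| ≤ |θ.re| + r ∧ |ζ.im| ≤ |θ.im| + r := by
  rw [mem_sphere, dist_eq_norm] at hζ
  have h1 : |(ζ - θ).re| ≤ r := hζ ▸ Complex.abs_re_le_norm _
  have h2 : |(ζ - θ).im| ≤ r := hζ ▸ Complex.abs_im_le_norm _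
  rw [Complex.sub_re] at h1
  rw [Complex.sub_im] at h2
  constructor
  · calc |ζ.re| = |θ.re + (ζ.re - θ.re)| := by ring_nf
      _ ≤ |θ.re| + |ζ.re - θ.re| := abs_add_le _ _
      _ ≤ |θ.re| + r := by linarith
  · calc |ζ.im| = |θ.im + (ζ.im - θ.im)| := by ring_nf
      _ ≤ |θ.im| + |ζ.im - θ.im| := abs_add_le _ _
      _ ≤ |θ.im| + r := by linarith

/-! ## Margins of compact time-ordered supports under small rotations -/

/-- **Margin lemma**: a compactly supported time-ordered one-point test function keeps its
(rotated) time coordinate `≥ δ > 0` under all rotations of angle `< ε₀` in the `(x₀,x₁)`-plane. [folklore] -/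
theorem exists_margin (F : 𝓢((Fin 1 → E4), ℂ)) (hF : IsTimeOrdered F)
    (hFc : HasCompactSupport (F : (Fin 1 → E4) → ℂ)) :
    ∃ ε₀ δ : ℝ, 0 < ε₀ ∧ 0 < δ ∧ ∀ a ∈ tsupport (F : (Fin 1 → E4) → ℂ), ∀ α : ℝ, |α| < ε₀ →
      δ ≤ Real.cos α * a 0 0 + Real.sin α * a 0 1 := by
  set K := tsupport (F : (Fin 1 → E4) → ℂ) with hKdef
  rcases K.eq_empty_or_nonempty with hK | hK
  · exact ⟨1, 1, one_pos, one_pos, fun a ha => (Set.eq_empty_iff_forall_notMem.mp hK a ha).elim⟩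
  · have hc0 : Continuous fun a : Fin 1 → E4 => a 0 0 := by fun_prop
    obtain ⟨a₀, ha₀, hmin⟩ := hFc.exists_isMinOn hK hc0.continuousOn
    have hm₀ : 0 < a₀ 0 0 := (hF ha₀).1 0
    have hc1 : Continuous fun a : Fin 1 → E4 => a 0 1 := by fun_prop
    obtain ⟨R, hR⟩ := hFc.exists_bound_of_continuousOn hc1.continuousOn
    have hR0 : 0 ≤ R := (norm_nonneg _).trans (hR a₀ ha₀)
    refine ⟨min 1 (a₀ 0 0 / (4 * (R + 1))), a₀ 0 0 / 4, lt_min one_pos (by positivity),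
      by positivity, fun a ha α hα => ?_⟩
    have hα1 : |α| < 1 := lt_of_lt_of_le hα (min_le_left _ _)
    have hα2 : |α| < a₀ 0 0 / (4 * (R + 1)) := lt_of_lt_of_le hα (min_le_right _ _)
    have hcos : 1 / 2 ≤ Real.cos α := by
      have h1 := Real.one_sub_sq_div_two_le_cos (x := α)
      have h2 : α ^ 2 ≤ 1 := by
        rw [← sq_abs]; nlinarith [abs_nonneg α]
      linarith
    have ha00 : a₀ 0 0 ≤ a 0 0 := (isMinOn_iff.mp hmin) a ha
    have ha01 : |a 0 1| ≤ R := by simpa [Real.norm_eq_abs] using hR a ha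
    have h3 : a₀ 0 0 / 2 ≤ Real.cos α * a 0 0 := by nlinarith
    have h4 : -(a₀ 0 0 / 4) ≤ Real.sin α * a 0 1 := by
      have h5 : |Real.sin α * a 0 1| ≤ a₀ 0 0 / (4 * (R + 1)) * R := by
        rw [abs_mul]
        exact mul_le_mul (Real.abs_sin_le_abs.trans hα2.le) ha01 (abs_nonneg _) (by positivity)
      have h6 : a₀ 0 0 / (4 * (R + 1)) * R ≤ a₀ 0 0 / 4 := by
        rw [div_mul_eq_mul_div, div_le_div_iff₀ (by positivity) (by positivity)]
        nlinarith
      linarith [neg_abs_le (Real.sin α * a 0 1)]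
    linarith

/-- **Small rotations keep a margined one-point function time-ordered.** [folklore] -/
theorem isTimeOrdered_linActMulti_planeRot (F : 𝓢((Fin 1 → E4), ℂ)) {ε₀ δ : ℝ} (hδ : 0 < δ)
    (hmargin : ∀ a ∈ tsupport (F : (Fin 1 → E4) → ℂ), ∀ α : ℝ, |α| < ε₀ →
      δ ≤ Real.cos α * a 0 0 + Real.sin α * a 0 1) {η : ℝ} (hη : |η| < ε₀) :
    IsTimeOrdered (linActMulti (planeRot (0 : Fin 3) η) F) := by
  intro x hx
  set L : (Fin 1 → E4) → (Fin 1 → E4) := fun x i => (planeRot (0 : Fin 3) η).symm (x i) with hL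
  have hLc : Continuous L :=
    continuous_pi fun i => (planeRot (0 : Fin 3) η).symm.continuous.comp (continuous_apply i)
  have hcoe : ((linActMulti (planeRot (0 : Fin 3) η) F : 𝓢((Fin 1 → E4), ℂ)) : (Fin 1 → E4) → ℂ) =
      (F : (Fin 1 → E4) → ℂ) ∘ L := by
    funext y; simp [hL, linActMulti_apply]
  have hLx : L x ∈ tsupport (F : (Fin 1 → E4) → ℂ) := by
    rw [hcoe] at hx
    exact tsupport_comp_subset_preimage _ hLc hx
  have key := hmargin (L x) hLx η hη
  have hx0 : x 0 0 = Real.cos η * L x 0 0 + Real.sin η * L x 0 1 := by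
    have h1 : x 0 = planeRot (0 : Fin 3) η (L x 0) := by simp [hL]
    rw [h1, planeRot_apply]
    simp
  refine ⟨fun i => ?_, fun i j hij => absurd hij (by simp [Subsingleton.elim i j])⟩
  rw [Subsingleton.elim i 0, hx0]
  linarith

/-- The diagonal action of an isometry preserves compact support. [folklore] -/
theorem hasCompactSupport_linActMulti (R : E4 ≃ₗᵢ[ℝ] E4) {F : 𝓢((Fin 1 → E4), ℂ)}
    (hFc : HasCompactSupport (F : (Fin 1 → E4) → ℂ)) :
    HasCompactSupport ((linActMulti R F : 𝓢((Fin 1 → E4), ℂ)) : (Fin 1 → E4) → ℂ) := by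
  have hcoe : ((linActMulti R F : 𝓢((Fin 1 → E4), ℂ)) : (Fin 1 → E4) → ℂ) =
      (F : (Fin 1 → E4) → ℂ) ∘ (Homeomorph.piCongrRight fun _ : Fin 1 => R.symm.toHomeomorph) := by
    funext x; simp [linActMulti_apply]; rfl
  rw [hcoe]
  exact hFc.comp_homeomorph _


/-! ## Schwartz-function bookkeeping -/

/-- Schwartz functions on `(ℝ⁴)¹` are integrable (the Haar instance of temperate growth, named
explicitly since instance search does not find it on the `Pi` type). [folklore] -/
theorem schwartz_integrable (G : 𝓢((Fin 1 → E4), ℂ)) : Integrable (G : (Fin 1 → E4) → ℂ) volume := by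
  haveI : (volume : Measure (Fin 1 → E4)).HasTemperateGrowth :=
    Measure.IsAddHaarMeasure.instHasTemperateGrowth
  exact G.integrable

/-- The support of a directional derivative of a Schwartz function lies in the support. [folklore] -/
theorem tsupport_lineDeriv_subset (G : 𝓢((Fin 1 → E4), ℂ)) (v : Fin 1 → E4) :
    tsupport ((∂_{v} G : 𝓢((Fin 1 → E4), ℂ)) : (Fin 1 → E4) → ℂ) ⊆
      tsupport (G : (Fin 1 → E4) → ℂ) := by
  have hcoe : ((∂_{v} G : 𝓢((Fin 1 → E4), ℂ)) : (Fin 1 → E4) → ℂ) =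
      (fun L : (Fin 1 → E4) →L[ℝ] ℂ => L v) ∘ fderiv ℝ (G : (Fin 1 → E4) → ℂ) := by
    funext a; exact SchwartzMap.lineDerivOp_apply_eq_fderiv v G a
  rw [hcoe]
  exact (closure_mono (Function.support_comp_subset (by simp) _)).trans (tsupport_fderiv_subset ℝ)

/-- Iterated directional derivatives do not enlarge the support. [folklore] -/
theorem tsupport_iterate_lineDeriv_subset (G : 𝓢((Fin 1 → E4), ℂ)) (v : Fin 1 → E4) (n : ℕ) :
    tsupport (((∂_{v})^[n] G : 𝓢((Fin 1 → E4), ℂ)) : (Fin 1 → E4) → ℂ) ⊆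
      tsupport (G : (Fin 1 → E4) → ℂ) := by
  induction n with
  | zero => exact subset_rfl
  | succ n ih =>
    rw [Function.iterate_succ_apply']
    exact (tsupport_lineDeriv_subset _ v).trans ih

/-- Iterated directional derivatives of a compactly supported Schwartz function are compactly
supported. [folklore] -/
theorem hasCompactSupport_iterate_lineDeriv (G : 𝓢((Fin 1 → E4), ℂ))
    (hGc : HasCompactSupport (G : (Fin 1 → E4) → ℂ)) (v : Fin 1 → E4) (n : ℕ) :
    HasCompactSupport (((∂_{v})^[n] G : 𝓢((Fin 1 → E4), ℂ)) : (Fin 1 → E4) → ℂ) :=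
  hGc.of_isClosed_subset (isClosed_tsupport _) (tsupport_iterate_lineDeriv_subset G v n)

/-- Scalar multiples of compactly supported test functions are compactly supported. [folklore] -/
theorem hasCompactSupport_smul (c : ℂ) {g : 𝓢((Fin 1 → E4), ℂ)}
    (hgc : HasCompactSupport (g : (Fin 1 → E4) → ℂ)) :
    HasCompactSupport ((c • g : 𝓢((Fin 1 → E4), ℂ)) : (Fin 1 → E4) → ℂ) :=
  hgc.mono fun x hx h0 => hx (show c * g x = 0 by rw [h0, mul_zero])

/-- **Pointwise polarisation** in `ℂ`. [folklore] -/
theorem polarization_pointwise (a b : ℂ) :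
    (((‖a + b‖ ^ 2 : ℝ) : ℂ) - ((‖a - b‖ ^ 2 : ℝ) : ℂ) +
      (((‖a - Complex.I * b‖ ^ 2 : ℝ) : ℂ) - ((‖a + Complex.I * b‖ ^ 2 : ℝ) : ℂ)) * Complex.I) / 4 =
    conj a * b := by
  simp only [Complex.sq_norm, Complex.normSq_apply]
  apply Complex.ext
  · simp; ring
  · simp; ring

end DegOne

end Summit.QuantumFields.YangMills.Theorems.NPointIsotropy.ComplexRotationBandlimit

end
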